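import Summits.QuantumFields.YangMills.Theorems.BalabanUVNodesN15KingModelCovariantDecay
import HarnessLib

/-!
# BalabanUVNodes ∕ N15 — THE KING-MODEL RUNG (PART Ͱ-g): THE DEPENDENCE OF THE FINE COVARIANCE ON THE LINK FIELD IS LOCAL AND LIPSCHITZ, WITH KING's `A = 0` KERNEL AS THE WEIGHT —
# `G_U − G_V = G_U(T_U − T_V)G_V` and `‖(G_U − G_V)_{xy}‖ ≤ c·Σ_{(z,μ)}‖U(z,μ) − V(z,μ)‖·(G(x,z)G(z+e_μ,y) + G(x,z+e_μ)G(z,y))` for ALL unitary `U, V`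
# (Track A, DAG node N15 = NE2 «η-rates ∕ defects of the covariance pieces under a change of background»; FAN-OUT v1.1 §N15 s3 «KING-MODEL RUNG»; count-neutral)

HONEST FRAMING.  Count-neutral (cell `pub-ymgap`, seat `pub-ymgap-dag-n15-e` g42; `--supports stmt-QuantumFields-27247 --as helper` = K3ᴬ, KEY MAP v3).  One finite torus at fixed
spacing; a LIPSCHITZ ∕ LOCALITY bound for the fine covariance layer — NOT [B9] (3.45)–(3.46)'s first-order expansion of `G(U)` around a smooth background (that is dag-n15-c's lane
and is not restated here), NOT Bałaban's `G_k(U)` (averaging penalty not of Kato form, Ͱ-a header); NOT a node discharge (N15 of record untouched); nothing continuum ∕ ℝ⁴ ∕ OS ∕ Clay.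

THE RESULT.  N15 = NE2 is about how the covariance pieces change with the spacing AND with the background.  On King's torus, with `G = (lapF K c m²)⁻¹` King's `A = 0` covariance and
`G_U = (−cΔ_U + m²)⁻¹` the covariant fine covariance of PART Ͱ-a at a unitary link field:
* §1 `blk_sub'`, `blk_mul'`, ★ **`covLapF_inv_sub_inv`** (THE SECOND RESOLVENT IDENTITY `G_U − G_V = G_U·(T_U − T_V)·G_V`, `T = ` the tree's hopping matrix `Hopping.hop`; the site
  weights cancel), ★ `blk_hop_sub_hop` (`(T_U − T_V)_{zw} = cΣ_μ([w = z+e_μ](U−V)(z,μ) + [w = z−e_μ](U−V)(z−e_μ,μ)^*)` — supported on the bonds where `U ≠ V`),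
  `l2_opNorm_blk_hop_sub_hop_le`;
* §2 `blk_hop_sub_hop_mul`, `l2_opNorm_blk_hop_sub_hop_mul_le`; ★★★ **`l2_opNorm_blk_inv_sub_inv_le`** — for ALL unitary `U, V`, all `x, y` (`c ≥ 0`, `m² > 0`):
  `‖(G_U − G_V)_{xy}‖_{op} ≤ Σ_zG(x,z)·c·Σ_μ(‖U(z,μ)−V(z,μ)‖·G(z+e_μ,y) + ‖U(z−e_μ,μ)−V(z−e_μ,μ)‖·G(z−e_μ,y))` (both factors dominated by Ͱ-b `l2_opNorm_blk_inv_le`; the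
  perturbation enters only through the bonds where the two fields differ, weighted by King's kernel from `x` to the bond and from the bond to `y`); ★★★
  **`l2_opNorm_blk_inv_sub_inv_le'`** (the bond-symmetric form `c·Σ_{(z,μ)}‖U(z,μ)−V(z,μ)‖·(G(x,z)G(z+e_μ,y) + G(x,z+e_μ)G(z,y))`);
* §3 consequences: ★★ **`l2_opNorm_blk_inv_sub_inv_le_of_sup`** (`≤ 2(d+1)·c·m⁻⁴·ε` when `‖U_b − V_b‖ ≤ ε` on every bond — Lipschitz in the sup distance of the fields, uniformly in the
  volume; Ε-e `lapF_inv_diag_le_inv_mass` + Ϟ-s `sum_lapF_inv_eq_inv_mass`), ★★ **`l2_opNorm_blk_inv_sub_free_le`** (`V ≡ 1`: `‖(G_U)_{xy} − G(x,y)·1‖ ≤ c·Σ‖U(z,μ) − 1‖·(…)` — the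
  covariant covariance differs from King's by at most FIRST ORDER in `‖U − 1‖_∞` with King-kernel weights), ★★ **`l2_opNorm_blk_inv_sub_inv_le_exp`** (each weight
  `G(x,z)G(z′,y) ≤ ((2∕m²)C)²·e^{−κ(d(x,z)+d(z′,y))}`, Ε-d: a change of the field on bonds at torus distance `≥ R` from both `x` and `y` moves `(G_U)_{xy}` by `O(e^{−κR})` — LOCALITY).

PRIOR TREE ART (by name): Ͱ-a (`covLapF`, `covLapF_eq`, `blk_covLapF`, `covLapF_mul_inv`, `covLapF_inv_mul`, `isUnit_det_covLapF`, `covLapF_free_inv_eq_kronecker`), Ͱ-b (`l2_opNorm_blk_inv_le`,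
`lapF_inv_entry_nonneg`), Ͱ-e (imports: Ε-d `abs_lapF_inv_le_exp_tdistT`, Ϟ-s `sum_lapF_inv_eq_inv_mass`, Ν-a `lapF_inv_comm`), Ε-e (`abs_lapF_inv_le_diag`, `lapF_inv_diag_le_inv_mass`),
`LatticeDiamagneticInequality` (`blk`, `Hopping.hop`), Mathlib (`Matrix.Norms.L2Operator`: `norm_mul_le`, `l2_opNorm_conjTranspose`).  Dedup (rg at filing): basename 0 files; needles
`covLapF_inv_sub_inv|blk_hop_sub_hop|l2_opNorm_blk_inv_sub_inv_le|l2_opNorm_blk_inv_sub_free_le|blk_hop_sub_hop_mul` 0 tree files.  Locators: [King1986] (4.4) p.670, Lemma 4.5 (4.38) p.674; [Balaban1985BackgroundPropagators]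
(3.23) p.394, (3.42) p.397, p.398 (gauge invariance ∕ random walk); [DodziukMathai2006] §1 Thm 1.5.  0 `sorry`, 0 `def`.
-/

noncomputable section

open scoped BigOperators ComplexConjugate ComplexOrder Kronecker Matrix.Norms.L2Operator
open Finset Matrix WithLp

namespace Summit.QuantumFields.YangMills.BalabanUVNodes.N15KingModelRung.Covariant

open Literature.MathematicalPhysics.QuantumFieldTheory.LatticeDiamagneticInequality (Hopping blk)
open Literature.MathematicalPhysics.QuantumFieldTheory.Balaban1983to89.B5Prop11Plancherel (Tor unitVec)
open Literature.MathematicalPhysics.QuantumFieldTheory.Balaban1983to89.B4TorusKernel (periodConst)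
open Literature.MathematicalPhysics.QuantumFieldTheory.King1986.Torus (lapF tdistT)
open Summit.QuantumFields.YangMills.BalabanUVNodes.N15KingModelRung.TorusSpectral (kappaFree abs_lapF_inv_le_exp_tdistT sum_lapF_inv_eq_inv_mass lapF_inv_comm
  abs_lapF_inv_le_diag lapF_inv_diag_le_inv_mass periodConst_kappaFree_nonneg)

variable {d : ℕ} (K : Fin (d + 1) → ℕ) [hK : ∀ μ, NeZero (K μ)]
variable {𝕜 : Type*} [RCLike 𝕜] {n : Type*} [Fintype n] [DecidableEq n] {c m2 : ℝ}

/-! ## §1 The second resolvent identity and the blocks of `T_U − T_V` -/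

omit hK [RCLike 𝕜] [Fintype n] [DecidableEq n] in
/-- Blocks of a difference. [folklore] -/
theorem blk_sub' {R : Type*} [Ring R] (M N : Matrix (Tor K × n) (Tor K × n) R) (x y : Tor K) : blk (M - N) x y = blk M x y - blk N x y := by
  ext i j; simp [blk]

omit [DecidableEq n] in
/-- Blocks of a product: `(MN)_{xy} = Σ_z M_{xz}N_{zy}`. [folklore] -/
theorem blk_mul' (M N : Matrix (Tor K × n) (Tor K × n) 𝕜) (x y : Tor K) : blk (M * N) x y = ∑ z, blk M x z * blk N z y := by
  ext i j
  simp only [blk, Matrix.of_apply, Matrix.mul_apply, Matrix.sum_apply]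
  rw [Fintype.sum_prod_type]

/-- ★ **THE SECOND RESOLVENT IDENTITY**: `G_U − G_V = G_U·(T_U − T_V)·G_V` for unitary `U, V` (`c ≥ 0`, `m² > 0`) — the site weights of `M_U = D − T_U` and `M_V = D − T_V` cancel.
[cite: Balaban1985BackgroundPropagators, (3.23) p.394; King1986, (4.4) p.670] -/
theorem covLapF_inv_sub_inv (hc : 0 ≤ c) (hm : 0 < m2) {U V : Tor K × Fin (d + 1) → Matrix n n 𝕜}
    (hU : ∀ b, U b ∈ Matrix.unitaryGroup n 𝕜) (hV : ∀ b, V b ∈ Matrix.unitaryGroup n 𝕜) :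
    (covLapF K c m2 U)⁻¹ - (covLapF K c m2 V)⁻¹
      = (covLapF K c m2 U)⁻¹ * ((kingHopping K c m2).hop U - (kingHopping K c m2).hop V) * (covLapF K c m2 V)⁻¹ := by
  have hdiff : (kingHopping K c m2).hop U - (kingHopping K c m2).hop V = covLapF K c m2 V - covLapF K c m2 U := by
    rw [covLapF_eq, covLapF_eq]; abel
  rw [hdiff, Matrix.mul_sub, Matrix.sub_mul, Matrix.mul_assoc, covLapF_mul_inv K hc hm hV, Matrix.mul_one, covLapF_inv_mul K hc hm hU, Matrix.one_mul]

omit [Fintype n] in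
/-- ★ THE BLOCKS OF `T_U − T_V`: `(T_U − T_V)_{zw} = c·Σ_μ([w = z+e_μ](U−V)(z,μ) + [w = z−e_μ]((U−V)(z−e_μ,μ))^*)` — supported on the bonds where the two link fields differ.
[cite: Balaban1985BackgroundPropagators, (3.23) p.394] -/
theorem blk_hop_sub_hop (c m2 : ℝ) (U V : Tor K × Fin (d + 1) → Matrix n n 𝕜) (z w : Tor K) :
    blk ((kingHopping K c m2).hop U - (kingHopping K c m2).hop V) z w
      = (c : 𝕜) • ∑ μ, ((if w = z + unitVec K μ then U (z, μ) - V (z, μ) else 0)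
          + (if w = z - unitVec K μ then (U (z - unitVec K μ, μ) - V (z - unitVec K μ, μ))ᴴ else 0)) := by
  have hdiff : (kingHopping K c m2).hop U - (kingHopping K c m2).hop V = covLapF K c m2 V - covLapF K c m2 U := by
    rw [covLapF_eq, covLapF_eq]; abel
  rw [hdiff, blk_sub', blk_covLapF, blk_covLapF, sub_sub_sub_cancel_left, ← smul_sub, ← Finset.sum_sub_distrib]
  congr 1
  refine Finset.sum_congr rfl fun μ _ => ?_
  rw [add_sub_add_comm]
  congr 1
  · split_ifs <;> simp
  · split_ifs <;> simp [conjTranspose_sub]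

/-- The operator norm of the blocks of `T_U − T_V`: `‖(T_U − T_V)_{zw}‖ ≤ c·Σ_μ([w = z+e_μ]‖U(z,μ)−V(z,μ)‖ + [w = z−e_μ]‖U(z−e_μ,μ)−V(z−e_μ,μ)‖)` (`c ≥ 0`). [folklore] -/
theorem l2_opNorm_blk_hop_sub_hop_le (hc : 0 ≤ c) (m2 : ℝ) (U V : Tor K × Fin (d + 1) → Matrix n n 𝕜) (z w : Tor K) :
    ‖blk ((kingHopping K c m2).hop U - (kingHopping K c m2).hop V) z w‖
      ≤ c * ∑ μ, ((if w = z + unitVec K μ then ‖U (z, μ) - V (z, μ)‖ else 0)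
          + (if w = z - unitVec K μ then ‖U (z - unitVec K μ, μ) - V (z - unitVec K μ, μ)‖ else 0)) := by
  rw [blk_hop_sub_hop, norm_smul, RCLike.norm_ofReal, abs_of_nonneg hc]
  refine mul_le_mul_of_nonneg_left ((norm_sum_le _ _).trans (Finset.sum_le_sum fun μ _ => (norm_add_le _ _).trans (add_le_add ?_ ?_))) hc
  · split_ifs <;> simp
  · split_ifs
    · rw [Matrix.l2_opNorm_conjTranspose]
    · simp

/-! ## §2 The Lipschitz ∕ locality bound -/

/-- The blocks of `(T_U − T_V)·B`: `((T_U − T_V)B)_{zy} = c·Σ_μ((U−V)(z,μ)·B_{z+e_μ,y} + (U−V)(z−e_μ,μ)^*·B_{z−e_μ,y})`. [folklore] -/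
theorem blk_hop_sub_hop_mul (c m2 : ℝ) (U V : Tor K × Fin (d + 1) → Matrix n n 𝕜) (B : Matrix (Tor K × n) (Tor K × n) 𝕜) (z y : Tor K) :
    blk (((kingHopping K c m2).hop U - (kingHopping K c m2).hop V) * B) z y
      = (c : 𝕜) • ∑ μ, ((U (z, μ) - V (z, μ)) * blk B (z + unitVec K μ) y
          + (U (z - unitVec K μ, μ) - V (z - unitVec K μ, μ))ᴴ * blk B (z - unitVec K μ) y) := by
  rw [blk_mul']
  have hw : ∀ w, blk ((kingHopping K c m2).hop U - (kingHopping K c m2).hop V) z w * blk B w y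
      = (c : 𝕜) • ∑ μ, ((if w = z + unitVec K μ then (U (z, μ) - V (z, μ)) * blk B w y else 0)
          + (if w = z - unitVec K μ then (U (z - unitVec K μ, μ) - V (z - unitVec K μ, μ))ᴴ * blk B w y else 0)) := by
    intro w
    rw [blk_hop_sub_hop, smul_mul_assoc, Finset.sum_mul]
    congr 1
    refine Finset.sum_congr rfl fun μ _ => ?_
    rw [add_mul]
    congr 1 <;> split_ifs <;> simp
  simp only [hw, ← Finset.smul_sum]
  congr 1
  rw [Finset.sum_comm]
  refine Finset.sum_congr rfl fun μ _ => ?_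
  rw [Finset.sum_add_distrib, Finset.sum_ite_eq' Finset.univ (z + unitVec K μ), Finset.sum_ite_eq' Finset.univ (z - unitVec K μ),
    if_pos (Finset.mem_univ _), if_pos (Finset.mem_univ _)]

/-- The operator norm of those blocks: `‖((T_U − T_V)B)_{zy}‖ ≤ c·Σ_μ(‖U(z,μ)−V(z,μ)‖·‖B_{z+e_μ,y}‖ + ‖U(z−e_μ,μ)−V(z−e_μ,μ)‖·‖B_{z−e_μ,y}‖)` (`c ≥ 0`). [folklore] -/
theorem l2_opNorm_blk_hop_sub_hop_mul_le (hc : 0 ≤ c) (m2 : ℝ) (U V : Tor K × Fin (d + 1) → Matrix n n 𝕜) (B : Matrix (Tor K × n) (Tor K × n) 𝕜) (z y : Tor K) :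
    ‖blk (((kingHopping K c m2).hop U - (kingHopping K c m2).hop V) * B) z y‖
      ≤ c * ∑ μ, (‖U (z, μ) - V (z, μ)‖ * ‖blk B (z + unitVec K μ) y‖
          + ‖U (z - unitVec K μ, μ) - V (z - unitVec K μ, μ)‖ * ‖blk B (z - unitVec K μ) y‖) := by
  rw [blk_hop_sub_hop_mul, norm_smul, RCLike.norm_ofReal, abs_of_nonneg hc]
  refine mul_le_mul_of_nonneg_left ((norm_sum_le _ _).trans (Finset.sum_le_sum fun μ _ => (norm_add_le _ _).trans (add_le_add (norm_mul_le _ _) ?_))) hc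
  refine (norm_mul_le _ _).trans (le_of_eq ?_)
  rw [Matrix.l2_opNorm_conjTranspose]

/-- ★★★ **THE LIPSCHITZ ∕ LOCALITY BOUND**: for ALL unitary link fields `U, V` (`c ≥ 0`, `m² > 0`) and all sites `x, y`,
`‖(G_U − G_V)_{xy}‖_{op} ≤ Σ_z G(x,z)·c·Σ_μ(‖U(z,μ)−V(z,μ)‖·G(z+e_μ,y) + ‖U(z−e_μ,μ)−V(z−e_μ,μ)‖·G(z−e_μ,y))` with `G = (c(−Δ)+m²)⁻¹` King's `A = 0` covariance — the
second resolvent identity with BOTH covariant factors dominated by King's kernel (PART Ͱ-b): the two fields' covariances differ only through the bonds where the fields differ.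
[cite: Balaban1985BackgroundPropagators, (3.23) p.394, (3.42) p.397; King1986, (4.4) p.670, (4.38) p.674; DodziukMathai2006, Thm 1.5 §1] -/
theorem l2_opNorm_blk_inv_sub_inv_le (hc : 0 ≤ c) (hm : 0 < m2) {U V : Tor K × Fin (d + 1) → Matrix n n 𝕜}
    (hU : ∀ b, U b ∈ Matrix.unitaryGroup n 𝕜) (hV : ∀ b, V b ∈ Matrix.unitaryGroup n 𝕜) (x y : Tor K) :
    ‖blk ((covLapF K c m2 U)⁻¹ - (covLapF K c m2 V)⁻¹) x y‖
      ≤ ∑ z, (lapF K c m2)⁻¹ x z * (c * ∑ μ, (‖U (z, μ) - V (z, μ)‖ * (lapF K c m2)⁻¹ (z + unitVec K μ) y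
          + ‖U (z - unitVec K μ, μ) - V (z - unitVec K μ, μ)‖ * (lapF K c m2)⁻¹ (z - unitVec K μ) y)) := by
  have hGnn : ∀ a b, 0 ≤ (lapF K c m2)⁻¹ a b := fun a b => lapF_inv_entry_nonneg K hc hm a b
  rw [covLapF_inv_sub_inv K hc hm hU hV, Matrix.mul_assoc, blk_mul']
  refine (norm_sum_le _ _).trans (Finset.sum_le_sum fun z _ => (norm_mul_le _ _).trans ?_)
  refine mul_le_mul (l2_opNorm_blk_inv_le K hc hm hU x z) ((l2_opNorm_blk_hop_sub_hop_mul_le K hc m2 U V _ z y).trans ?_) (norm_nonneg _) (hGnn x z)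
  refine mul_le_mul_of_nonneg_left (Finset.sum_le_sum fun μ _ => add_le_add ?_ ?_) hc
  · exact mul_le_mul_of_nonneg_left (l2_opNorm_blk_inv_le K hc hm hV _ y) (norm_nonneg _)
  · exact mul_le_mul_of_nonneg_left (l2_opNorm_blk_inv_le K hc hm hV _ y) (norm_nonneg _)

/-- ★★★ **THE BOND-SYMMETRIC FORM**: `‖(G_U − G_V)_{xy}‖_{op} ≤ c·Σ_{(z,μ)}‖U(z,μ) − V(z,μ)‖·(G(x,z)·G(z+e_μ,y) + G(x,z+e_μ)·G(z,y))` — one term per bond, weighted by King's kernel from `x`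
to one end of the bond times King's kernel from the other end to `y`. [cite: Balaban1985BackgroundPropagators, (3.23) p.394, (3.42) p.397; King1986, (4.4) p.670] -/
theorem l2_opNorm_blk_inv_sub_inv_le' (hc : 0 ≤ c) (hm : 0 < m2) {U V : Tor K × Fin (d + 1) → Matrix n n 𝕜}
    (hU : ∀ b, U b ∈ Matrix.unitaryGroup n 𝕜) (hV : ∀ b, V b ∈ Matrix.unitaryGroup n 𝕜) (x y : Tor K) :
    ‖blk ((covLapF K c m2 U)⁻¹ - (covLapF K c m2 V)⁻¹) x y‖
      ≤ c * ∑ z, ∑ μ, ‖U (z, μ) - V (z, μ)‖ * ((lapF K c m2)⁻¹ x z * (lapF K c m2)⁻¹ (z + unitVec K μ) y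
          + (lapF K c m2)⁻¹ x (z + unitVec K μ) * (lapF K c m2)⁻¹ z y) := by
  set G := (lapF K c m2)⁻¹ with hG
  refine (l2_opNorm_blk_inv_sub_inv_le K hc hm hU hV x y).trans (le_of_eq ?_)
  -- reindex the backward-bond half of the sum by `z ↦ z + e_μ`
  have hre : ∀ μ : Fin (d + 1), ∑ z, G x z * (‖U (z - unitVec K μ, μ) - V (z - unitVec K μ, μ)‖ * G (z - unitVec K μ) y)
      = ∑ z, G x (z + unitVec K μ) * (‖U (z, μ) - V (z, μ)‖ * G z y) := fun μ =>
    (Fintype.sum_equiv (Equiv.addRight (unitVec K μ))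
      (fun z => G x (z + unitVec K μ) * (‖U (z, μ) - V (z, μ)‖ * G z y))
      (fun z => G x z * (‖U (z - unitVec K μ, μ) - V (z - unitVec K μ, μ)‖ * G (z - unitVec K μ) y))
      (fun z => by simp only [Equiv.coe_addRight, add_sub_cancel_right])).symm
  calc ∑ z, G x z * (c * ∑ μ, (‖U (z, μ) - V (z, μ)‖ * G (z + unitVec K μ) y + ‖U (z - unitVec K μ, μ) - V (z - unitVec K μ, μ)‖ * G (z - unitVec K μ) y))
      = c * ∑ μ, (∑ z, G x z * (‖U (z, μ) - V (z, μ)‖ * G (z + unitVec K μ) y)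
          + ∑ z, G x z * (‖U (z - unitVec K μ, μ) - V (z - unitVec K μ, μ)‖ * G (z - unitVec K μ) y)) := by
        simp only [Finset.mul_sum, mul_add, Finset.sum_add_distrib]
        congr 1 <;> (rw [Finset.sum_comm]; exact Finset.sum_congr rfl fun μ _ => Finset.sum_congr rfl fun z _ => by ring)
    _ = c * ∑ z, ∑ μ, ‖U (z, μ) - V (z, μ)‖ * (G x z * G (z + unitVec K μ) y + G x (z + unitVec K μ) * G z y) := by
        congr 1
        rw [Finset.sum_comm]
        refine Finset.sum_congr rfl fun μ _ => ?_
        rw [hre μ, ← Finset.sum_add_distrib]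
        exact Finset.sum_congr rfl fun z _ => by ring

/-! ## §3 Consequences: Lipschitz in the sup distance; first order around King; exponential locality -/

/-- ★★ **LIPSCHITZ IN THE SUP DISTANCE OF THE FIELDS**: if `‖U_b − V_b‖ ≤ ε` on every bond then `‖(G_U − G_V)_{xy}‖_{op} ≤ 2(d+1)·c·ε·m⁻⁴`, uniformly in the volume (each
King weight `≤ 1∕m²` by Ε-e, each King row sum `= 1∕m²` by Ϟ-s). [cite: King1986, (2.17) p.653, (4.4) p.670; Balaban1985BackgroundPropagators, (3.42) p.397] -/
theorem l2_opNorm_blk_inv_sub_inv_le_of_sup (hc : 0 ≤ c) (hm : 0 < m2) {U V : Tor K × Fin (d + 1) → Matrix n n 𝕜}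
    (hU : ∀ b, U b ∈ Matrix.unitaryGroup n 𝕜) (hV : ∀ b, V b ∈ Matrix.unitaryGroup n 𝕜) {ε : ℝ} (hε : ∀ b, ‖U b - V b‖ ≤ ε) (x y : Tor K) :
    ‖blk ((covLapF K c m2 U)⁻¹ - (covLapF K c m2 V)⁻¹) x y‖ ≤ 2 * ((d : ℝ) + 1) * c * ε * (m2⁻¹ * m2⁻¹) := by
  set G := (lapF K c m2)⁻¹ with hG
  have hGnn : ∀ a b, 0 ≤ G a b := fun a b => lapF_inv_entry_nonneg K hc hm a b
  have hGle : ∀ a b, G a b ≤ m2⁻¹ := fun a b =>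
    ((le_abs_self _).trans (by rw [hG, lapF_inv_comm K c m2 a b]; exact abs_lapF_inv_le_diag K hc hm b a)).trans (lapF_inv_diag_le_inv_mass K hc hm b)
  have hε0 : 0 ≤ ε := (norm_nonneg _).trans (hε ((0 : Tor K), 0))
  refine (l2_opNorm_blk_inv_sub_inv_le K hc hm hU hV x y).trans ?_
  have hinner : ∀ z, c * ∑ μ : Fin (d + 1), (‖U (z, μ) - V (z, μ)‖ * G (z + unitVec K μ) y + ‖U (z - unitVec K μ, μ) - V (z - unitVec K μ, μ)‖ * G (z - unitVec K μ) y)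
      ≤ c * (((d : ℝ) + 1) * (2 * ε * m2⁻¹)) := by
    intro z
    refine mul_le_mul_of_nonneg_left ?_ hc
    calc ∑ μ : Fin (d + 1), (‖U (z, μ) - V (z, μ)‖ * G (z + unitVec K μ) y + ‖U (z - unitVec K μ, μ) - V (z - unitVec K μ, μ)‖ * G (z - unitVec K μ) y)
        ≤ ∑ _μ : Fin (d + 1), (ε * m2⁻¹ + ε * m2⁻¹) :=
          Finset.sum_le_sum fun μ _ => add_le_add (mul_le_mul (hε _) (hGle _ _) (hGnn _ _) hε0) (mul_le_mul (hε _) (hGle _ _) (hGnn _ _) hε0)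
      _ = ((d : ℝ) + 1) * (2 * ε * m2⁻¹) := by
          rw [Finset.sum_const, Finset.card_univ, Fintype.card_fin, nsmul_eq_mul]; push_cast; ring
  calc ∑ z, G x z * (c * ∑ μ, (‖U (z, μ) - V (z, μ)‖ * G (z + unitVec K μ) y + ‖U (z - unitVec K μ, μ) - V (z - unitVec K μ, μ)‖ * G (z - unitVec K μ) y))
      ≤ ∑ z, G x z * (c * (((d : ℝ) + 1) * (2 * ε * m2⁻¹))) := Finset.sum_le_sum fun z _ => mul_le_mul_of_nonneg_left (hinner z) (hGnn x z)
    _ = 2 * ((d : ℝ) + 1) * c * ε * (m2⁻¹ * m2⁻¹) := by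
        rw [← Finset.sum_mul, hG, sum_lapF_inv_eq_inv_mass K hc hm x]; ring

/-- The blocks of King's own covariance `G_1 = G ⊗ 1`: `(G_1)_{xy} = G(x,y)·1ₙ` (Ͱ-a `covLapF_free_inv_eq_kronecker`). [cite: King1986, (4.4) p.670] -/
theorem blk_covLapF_free_inv (hc : 0 ≤ c) (hm : 0 < m2) (x y : Tor K) :
    blk ((covLapF K c m2 (Hopping.free : Tor K × Fin (d + 1) → Matrix n n 𝕜))⁻¹) x y = (((lapF K c m2)⁻¹ x y : ℝ) : 𝕜) • (1 : Matrix n n 𝕜) := by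
  ext i j
  simp only [blk, Matrix.of_apply, covLapF_free_inv_apply K hc hm, Matrix.smul_apply, Matrix.one_apply, smul_eq_mul]

/-- ★★ **FIRST ORDER AROUND KING**: at every unitary `U`, `‖(G_U)_{xy} − G(x,y)·1‖_{op} ≤ c·Σ_{(z,μ)}‖U(z,μ) − 1‖·(G(x,z)G(z+e_μ,y) + G(x,z+e_μ)G(z,y))` — the covariant fine
covariance differs from King's `A = 0` covariance by at most first order in the distance of the link field from the identity, with King-kernel weights (what the curved case
adds, quantitatively; NOT [B9] (3.45)'s derivative expansion). [cite: King1986, (4.4) p.670, (4.38) p.674; Balaban1985BackgroundPropagators, (3.42) p.397] -/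
theorem l2_opNorm_blk_inv_sub_free_le (hc : 0 ≤ c) (hm : 0 < m2) {U : Tor K × Fin (d + 1) → Matrix n n 𝕜} (hU : ∀ b, U b ∈ Matrix.unitaryGroup n 𝕜) (x y : Tor K) :
    ‖blk ((covLapF K c m2 U)⁻¹) x y - (((lapF K c m2)⁻¹ x y : ℝ) : 𝕜) • (1 : Matrix n n 𝕜)‖
      ≤ c * ∑ z, ∑ μ, ‖U (z, μ) - 1‖ * ((lapF K c m2)⁻¹ x z * (lapF K c m2)⁻¹ (z + unitVec K μ) y
          + (lapF K c m2)⁻¹ x (z + unitVec K μ) * (lapF K c m2)⁻¹ z y) := by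
  have h := l2_opNorm_blk_inv_sub_inv_le' K hc hm hU (free_mem_unitaryGroup K) x y
  rwa [blk_sub', blk_covLapF_free_inv K hc hm] at h

/-- ★★ **EXPONENTIAL LOCALITY**: with Ε-d's constants `C = (2∕m²)·periodConst κ_F d`, `κ = κ_F∕(d+1)`, at all unitary `U, V`:
`‖(G_U − G_V)_{xy}‖_{op} ≤ c·C²·Σ_{(z,μ)}‖U(z,μ)−V(z,μ)‖·(e^{−κ(d(x,z)+d(z+e_μ,y))} + e^{−κ(d(x,z+e_μ)+d(z,y))})` — a change of the link field on bonds far from both `x` and `y` moves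
`(G_U)_{xy}` exponentially little, uniformly in the volume and in the fields. [cite: King1986, (4.4) p.670, (4.38) p.674; Balaban1984PropagatorsI, p.38 (1.126); Balaban1985BackgroundPropagators, (3.42) p.397] -/
theorem l2_opNorm_blk_inv_sub_inv_le_exp (hc : 0 ≤ c) (hm : 0 < m2) {U V : Tor K × Fin (d + 1) → Matrix n n 𝕜}
    (hU : ∀ b, U b ∈ Matrix.unitaryGroup n 𝕜) (hV : ∀ b, V b ∈ Matrix.unitaryGroup n 𝕜) (x y : Tor K) :
    ‖blk ((covLapF K c m2 U)⁻¹ - (covLapF K c m2 V)⁻¹) x y‖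
      ≤ c * (2 / m2 * periodConst (kappaFree c m2 d) d) ^ 2 * ∑ z, ∑ μ, ‖U (z, μ) - V (z, μ)‖ *
          (Real.exp (-(kappaFree c m2 d / (d + 1) * (tdistT K x z + tdistT K (z + unitVec K μ) y)))
            + Real.exp (-(kappaFree c m2 d / (d + 1) * (tdistT K x (z + unitVec K μ) + tdistT K z y)))) := by
  set C := 2 / m2 * periodConst (kappaFree c m2 d) d with hC
  set κ := kappaFree c m2 d / (d + 1) with hκ
  have hC0 : 0 ≤ C := periodConst_kappaFree_nonneg hc hm
  have hGnn : ∀ a b, 0 ≤ (lapF K c m2)⁻¹ a b := fun a b => lapF_inv_entry_nonneg K hc hm a b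
  have hGle : ∀ a b, (lapF K c m2)⁻¹ a b ≤ C * Real.exp (-(κ * tdistT K a b)) := fun a b =>
    (le_abs_self _).trans (abs_lapF_inv_le_exp_tdistT K hc hm a b)
  have hprod : ∀ a b a' b', (lapF K c m2)⁻¹ a b * (lapF K c m2)⁻¹ a' b' ≤ C ^ 2 * Real.exp (-(κ * (tdistT K a b + tdistT K a' b'))) := by
    intro a b a' b'
    calc (lapF K c m2)⁻¹ a b * (lapF K c m2)⁻¹ a' b' ≤ (C * Real.exp (-(κ * tdistT K a b))) * (C * Real.exp (-(κ * tdistT K a' b'))) :=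
          mul_le_mul (hGle a b) (hGle a' b') (hGnn _ _) (mul_nonneg hC0 (Real.exp_nonneg _))
      _ = C ^ 2 * Real.exp (-(κ * (tdistT K a b + tdistT K a' b'))) := by
          rw [mul_add, neg_add, Real.exp_add]; ring
  have hS : ∑ z, ∑ μ, ‖U (z, μ) - V (z, μ)‖ * ((lapF K c m2)⁻¹ x z * (lapF K c m2)⁻¹ (z + unitVec K μ) y + (lapF K c m2)⁻¹ x (z + unitVec K μ) * (lapF K c m2)⁻¹ z y)
      ≤ C ^ 2 * ∑ z, ∑ μ, ‖U (z, μ) - V (z, μ)‖ *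
          (Real.exp (-(κ * (tdistT K x z + tdistT K (z + unitVec K μ) y))) + Real.exp (-(κ * (tdistT K x (z + unitVec K μ) + tdistT K z y)))) := by
    rw [Finset.mul_sum]
    refine Finset.sum_le_sum fun z _ => ?_
    rw [Finset.mul_sum]
    refine Finset.sum_le_sum fun μ _ => ?_
    rw [mul_left_comm]
    refine mul_le_mul_of_nonneg_left ?_ (norm_nonneg _)
    rw [mul_add]
    exact add_le_add (hprod _ _ _ _) (hprod _ _ _ _)
  calc _ ≤ _ := l2_opNorm_blk_inv_sub_inv_le' K hc hm hU hV x y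
    _ ≤ c * (C ^ 2 * ∑ z, ∑ μ, ‖U (z, μ) - V (z, μ)‖ *
          (Real.exp (-(κ * (tdistT K x z + tdistT K (z + unitVec K μ) y))) + Real.exp (-(κ * (tdistT K x (z + unitVec K μ) + tdistT K z y))))) :=
        mul_le_mul_of_nonneg_left hS hc
    _ = _ := by rw [mul_assoc]

end Summit.QuantumFields.YangMills.BalabanUVNodes.N15KingModelRung.Covariant

end
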